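import Mathlib.Algebra.Group.Pointwise.Finset.Basic
import Literature.Combinatorics.Additive.TripleProductProperty
import HarnessLib

/-!
# Basic TPP triples via two quotient-set intersections (Hedtke–Murthy 2012, Theorem 3.1)

Topic `Literature/Combinatorics/Additive` (companion of `TripleProductProperty.lean` and
`TPPSingleQuotientCriterion.lean`, Lemma 5.3 of the same paper).

I. Hedtke, S. Murthy, *Search and test algorithms for triple product property triples*, Groups Complex.
Cryptol. 4 (2012), doi:10.1515/gcc-2012-0006 = arXiv:1104.5097, §3, Theorem 3.1 (held text
`paper:arxiv-1104.5097` chunk p0006 L5–14), verbatim: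

> **Theorem 3.1.** Three subsets of `G` form a basic TPP triple `(S, T, U)` iff
> (i) `1 ∈ S ∩ T ∩ U`, (ii) `Q(T) ∩ Q(U) = 1` and (iii) `Q(S) ∩ Q(T)Q(U) = 1`.
> This is not a limitation, because we only need to search for basic TPP triples.
> *Proof.* First assume that `(S,T,U)` is a basic TPP triple. (i) follows directly from the definition
> and (ii) from (**). Furthermore (*) implies that `1 ∈ Q(S) ∩ Q(T)Q(U)`. Now assume there is a common
> element `1 ≠ x ∈ Q(S) ∩ Q(T)Q(U)`. Then `x = s = tu`, for some `s ∈ Q(S)` and `tu ∈ Q(T)Q(U)`. This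
> means `1 = x⁻¹x = s⁻¹tu`, but the TPP for `(S,T,U)` implies that `1 = s⁻¹ = t = u` and therefore
> `x = 1`, a contradiction. Now assume that the equations (i)–(iii) hold […] Consider the triple quotient
> product `stu` for arbitrary elements `s ∈ Q(S)`, `t ∈ Q(T)` and `u ∈ Q(U)`. Then `stu = 1` is
> equivalent to `s⁻¹ = tu`. Now (iii) implies that `s⁻¹ = tu = 1` and (*) together with (ii) imply that
> `t = u = 1` and so `(S,T,U)` is a basic TPP triple. □

Here a *basic* TPP triple is a TPP triple with `1 ∈ S ∩ T ∩ U` (the paper's Def. 2.8, after Neumann;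
every TPP triple is a translate of a basic one), `Q(X) = X X⁻¹` is the right quotient set (Def. 1.1) and
the TPP is the tree's `TripleProductProperty` (Cohn–Umans 2003 Def. 2.1 = the paper's Def. 1.2).  The two
set equations are rendered as `T T⁻¹ ∩ U U⁻¹ = {1}` and `S S⁻¹ ∩ (T T⁻¹ · U U⁻¹) = {1}` (pointwise
`Finset` products).  As in the paper's standing Def. 1.2 the sets are non-empty where that matters: the
forward implications need an element of the uninvolved set (made explicit below); the converse needs
nothing.

## What is here (all proved; 0 definitions, 0 named facts)

* `TripleProductProperty.quot_inter_quot_eq_one` — TPP (with `S, T, U ≠ ∅`) ⇒ `Q(T) ∩ Q(U) = {1}`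
  (condition (ii); the paper's Lemma 2.1 (**));
* `TripleProductProperty.quot_inter_quot_mul_quot_eq_one` — TPP (with `S, T, U ≠ ∅`) ⇒
  `Q(S) ∩ Q(T)Q(U) = {1}` (condition (iii));
* `tripleProductProperty_of_quot_inter` — (ii) ∧ (iii) ⇒ TPP;
* `HedtkeMurthy2012_thm31` — **Theorem 3.1** as printed: "basic TPP triple" ↔ (i) ∧ (ii) ∧ (iii).

## References
* I. Hedtke, S. Murthy, arXiv:1104.5097 = Groups Complex. Cryptol. 4 (2012): Thm. 3.1 with proof; Def. 2.8;
  Lemma 2.1. [HedtkeMurthy2012]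
* H. Cohn, C. Umans, FOCS 2003, arXiv:math/0307321, Def. 2.1 (the TPP). [CohnUmans2003]
-/

open Finset
open scoped Pointwise

namespace Literature.Combinatorics.Additive

variable {G : Type*} [Group G] [DecidableEq G]

/-- TPP ⇒ `Q(T) ∩ Q(U) = {1}` (condition (ii) of Thm. 3.1; needs an element of `S` for the TPP relation
and of `T`, `U` for `1 ∈ Q(T) ∩ Q(U)`): `t t'⁻¹ = u u'⁻¹ =: x` gives the relation
`s s⁻¹ · t t'⁻¹ · u' u⁻¹ = 1`, so `t = t'` and `x = 1`. [cite: HedtkeMurthy2012, Theorem 3.1 (ii)] -/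
theorem TripleProductProperty.quot_inter_quot_eq_one {S T U : Finset G}
    (h : TripleProductProperty S T U) (hS : S.Nonempty) (hT : T.Nonempty) (hU : U.Nonempty) :
    (T * T⁻¹) ∩ (U * U⁻¹) = {1} := by
  obtain ⟨s, hs⟩ := hS
  obtain ⟨t₀, ht₀⟩ := hT
  obtain ⟨u₀, hu₀⟩ := hU
  ext x
  simp only [Finset.mem_inter, Finset.mem_singleton]
  constructor
  · rintro ⟨hxT, hxU⟩
    rw [Finset.mem_mul] at hxT hxU
    obtain ⟨t, ht, a, ha, rfl⟩ := hxT
    obtain ⟨u, hu, b, hb, he⟩ := hxU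
    rw [Finset.mem_inv'] at ha hb
    have hrel : s * s⁻¹ * (t * a⁻¹⁻¹) * (b⁻¹ * u⁻¹) = 1 := by
      rw [mul_inv_cancel, one_mul, inv_inv, ← mul_inv_rev, he, mul_inv_cancel]
    obtain ⟨-, h2, -⟩ := h s hs s hs t ht _ ha _ hb u hu hrel
    rw [h2, inv_mul_cancel]
  · rintro rfl
    constructor
    · simpa only [mul_inv_cancel] using Finset.mul_mem_mul ht₀ (Finset.inv_mem_inv ht₀)
    · simpa only [mul_inv_cancel] using Finset.mul_mem_mul hu₀ (Finset.inv_mem_inv hu₀)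

/-- TPP ⇒ `Q(S) ∩ Q(T) Q(U) = {1}` (condition (iii) of Thm. 3.1; non-emptiness only for `1 ∈` both
sides): `x = s s'⁻¹ = (t t'⁻¹)(u u'⁻¹)` gives the relation `s' s⁻¹ · t t'⁻¹ · u u'⁻¹ = x⁻¹ x = 1`,
so `s' = s` and `x = 1`. [cite: HedtkeMurthy2012, Theorem 3.1 (iii)] -/
theorem TripleProductProperty.quot_inter_quot_mul_quot_eq_one {S T U : Finset G}
    (h : TripleProductProperty S T U) (hS : S.Nonempty) (hT : T.Nonempty) (hU : U.Nonempty) :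
    (S * S⁻¹) ∩ (T * T⁻¹ * (U * U⁻¹)) = {1} := by
  obtain ⟨s₀, hs₀⟩ := hS
  obtain ⟨t₀, ht₀⟩ := hT
  obtain ⟨u₀, hu₀⟩ := hU
  ext x
  simp only [Finset.mem_inter, Finset.mem_singleton]
  constructor
  · rintro ⟨hxS, hxTU⟩
    rw [Finset.mem_mul] at hxS hxTU
    obtain ⟨s, hs, a, ha, rfl⟩ := hxS
    obtain ⟨y, hy, z, hz, he⟩ := hxTU
    rw [Finset.mem_mul] at hy hz
    obtain ⟨t, ht, c, hc, rfl⟩ := hy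
    obtain ⟨u, hu, d, hd, rfl⟩ := hz
    rw [Finset.mem_inv'] at ha hc hd
    have hrel : a⁻¹ * s⁻¹ * (t * c⁻¹⁻¹) * (u * d⁻¹⁻¹) = 1 := by
      rw [inv_inv, inv_inv, ← mul_inv_rev, mul_assoc, he, inv_mul_cancel]
    obtain ⟨h1, -, -⟩ := h _ ha s hs t ht _ hc u hu _ hd hrel
    rw [← h1, inv_mul_cancel]
  · rintro rfl
    constructor
    · simpa only [mul_inv_cancel] using Finset.mul_mem_mul hs₀ (Finset.inv_mem_inv hs₀)
    · have h1 : (1 : G) * 1 ∈ T * T⁻¹ * (U * U⁻¹) :=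
        Finset.mul_mem_mul
          (by simpa only [mul_inv_cancel] using Finset.mul_mem_mul ht₀ (Finset.inv_mem_inv ht₀))
          (by simpa only [mul_inv_cancel] using Finset.mul_mem_mul hu₀ (Finset.inv_mem_inv hu₀))
      rwa [mul_one] at h1

/-- Conditions (ii) and (iii) of Thm. 3.1 imply the TPP: from `s s'⁻¹ (t t'⁻¹)(u u'⁻¹) = 1` the element
`(t t'⁻¹)(u u'⁻¹) = s' s⁻¹` lies in `Q(S) ∩ Q(T)Q(U) = {1}`, so `s = s'`; then `t t'⁻¹ = u' u⁻¹` lies in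
`Q(T) ∩ Q(U) = {1}`, so `t = t'` and `u = u'`. [cite: HedtkeMurthy2012, Theorem 3.1 (proof, ⇐)] -/
theorem tripleProductProperty_of_quot_inter {S T U : Finset G}
    (h2 : (T * T⁻¹) ∩ (U * U⁻¹) = {1}) (h3 : (S * S⁻¹) ∩ (T * T⁻¹ * (U * U⁻¹)) = {1}) :
    TripleProductProperty S T U := by
  intro s hs s' hs' t ht t' ht' u hu u' hu' hrel
  have hy : t * t'⁻¹ ∈ T * T⁻¹ := Finset.mul_mem_mul ht (Finset.inv_mem_inv ht')
  have hz : u * u'⁻¹ ∈ U * U⁻¹ := Finset.mul_mem_mul hu (Finset.inv_mem_inv hu')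
  have hyz_mem : t * t'⁻¹ * (u * u'⁻¹) ∈ T * T⁻¹ * (U * U⁻¹) := Finset.mul_mem_mul hy hz
  rw [mul_assoc (s * s'⁻¹)] at hrel
  -- `y z = (s s'⁻¹)⁻¹ = s' s⁻¹ ∈ Q(S)`
  have hyz : t * t'⁻¹ * (u * u'⁻¹) = s' * s⁻¹ := by
    rw [eq_inv_of_mul_eq_one_right hrel, mul_inv_rev, inv_inv]
  have hmemS : s' * s⁻¹ ∈ S * S⁻¹ := Finset.mul_mem_mul hs' (Finset.inv_mem_inv hs)
  have hone : s' * s⁻¹ = 1 := by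
    have hx : s' * s⁻¹ ∈ (S * S⁻¹) ∩ (T * T⁻¹ * (U * U⁻¹)) :=
      Finset.mem_inter.2 ⟨hmemS, hyz ▸ hyz_mem⟩
    rw [h3, Finset.mem_singleton] at hx
    exact hx
  have hss : s' = s := mul_inv_eq_one.1 hone
  rw [hone] at hyz
  -- `y = z⁻¹ = u' u⁻¹ ∈ Q(U)`, so `y ∈ Q(T) ∩ Q(U) = {1}`
  have hy' : t * t'⁻¹ = u' * u⁻¹ := by
    rw [eq_inv_of_mul_eq_one_left hyz, mul_inv_rev, inv_inv]
  have hyone : t * t'⁻¹ = 1 := by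
    have hx : t * t'⁻¹ ∈ (T * T⁻¹) ∩ (U * U⁻¹) :=
      Finset.mem_inter.2 ⟨hy, hy' ▸ Finset.mul_mem_mul hu' (Finset.inv_mem_inv hu)⟩
    rw [h2, Finset.mem_singleton] at hx
    exact hx
  have hzone : u * u'⁻¹ = 1 := by rw [hyone, one_mul] at hyz; exact hyz
  exact ⟨hss.symm, mul_inv_eq_one.1 hyone, mul_inv_eq_one.1 hzone⟩

/-- **Hedtke–Murthy 2012, Theorem 3.1**: finite subsets `S, T, U` of a group form a *basic* TPP triple
(`1 ∈ S ∩ T ∩ U` and the triple product property) iff (i) `1 ∈ S ∩ T ∩ U`, (ii) `Q(T) ∩ Q(U) = {1}` and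
(iii) `Q(S) ∩ Q(T)Q(U) = {1}`, with `Q(X) = X X⁻¹`. [cite: HedtkeMurthy2012, Theorem 3.1] -/
theorem HedtkeMurthy2012_thm31 (S T U : Finset G) :
    ((1 : G) ∈ S ∧ (1 : G) ∈ T ∧ (1 : G) ∈ U) ∧ TripleProductProperty S T U ↔
      ((1 : G) ∈ S ∧ (1 : G) ∈ T ∧ (1 : G) ∈ U) ∧ (T * T⁻¹) ∩ (U * U⁻¹) = {1} ∧
        (S * S⁻¹) ∩ (T * T⁻¹ * (U * U⁻¹)) = {1} := by
  constructor
  · rintro ⟨⟨h1S, h1T, h1U⟩, h⟩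
    exact ⟨⟨h1S, h1T, h1U⟩, h.quot_inter_quot_eq_one ⟨1, h1S⟩ ⟨1, h1T⟩ ⟨1, h1U⟩,
      h.quot_inter_quot_mul_quot_eq_one ⟨1, h1S⟩ ⟨1, h1T⟩ ⟨1, h1U⟩⟩
  · rintro ⟨h1, h2, h3⟩
    exact ⟨h1, tripleProductProperty_of_quot_inter h2 h3⟩

end Literature.Combinatorics.Additive
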